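import Summits.RiemannHypothesis.RiemannHypothesis.Theorems.IntegerScrewCensusFastErr

/-!
# Route `IntegerScrew` — fast kernel arithmetic for manifest-certificate checks (9a): the offset arithmetic of a pair

ABSTRACT form of the two arguments of `pairAbs` (`IntegerScrewCensusFastCheck`): with the node quantities as free naturals
(`xa = ua₁ + NA + ZB − F4`, `xb = ub₁ + NB + ZB − F45`, `ya = ua₂ + NA + F4`, `yb = ub₂ + NB + F45`, the pair identity
`kc + ks + POS − (NA + NB) = Num` of `IntegerScrewCensusFastPair.pair_num`, and the size caps of `fastLight`) NO truncation
occurs and `A1 = CL + 4ZB + ua₁ + ub₁ − uab₂ − Num − (F4 + F45)`, `A2 = CH + 2ZB + ua₂ + ub₂ − uab₁ − Num + (F4 + F45)`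
(`offsetA1`, `offsetA2`); and `abs_le_pairMax`: from `(OZ + 4ZB) − A1 ≥ −2^164 R` and `A2 − (OZ + 2ZB) ≥ 2^164 R` the checker's
`max ((OZ+4ZB) ∸ A1) (A2 ∸ (OZ+2ZB)) ≥ 2^164 |R|`.  Also `sumN_le_of_le`, `kdotS_lt`.  (Kernel note: inequalities between a free
variable and the big constants are proved by monotonicity + `omega`, never by `norm_num` — whose proof terms make the kernel
evaluate `Nat.ble` structurally.)  Pure arithmetic; RH-free and ζ-free; nothing here bears on the truth of RH.
-/

set_option linter.dupNamespace false
set_option autoImplicit false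

namespace Summit.RiemannHypothesis.RiemannHypothesis.Theorems.IntegerScrew.Manifest.Fast

open Finset
open Literature.Analysis.ValidatedNumerics Literature.Analysis.ValidatedNumerics.Numerics
open Literature.Analysis.ValidatedNumerics.KroneckerDot

/-- `sumN` of a list of naturals `≤ B` is `≤ length·B`. -/
theorem sumN_le_of_le {l : List ℕ} {B : ℕ} (h : ∀ x ∈ l, x ≤ B) : sumN l ≤ l.length * B := by
  induction l with
  | nil => simp [sumN]
  | cons a t ih =>
    rw [sumN, List.length_cons, Nat.succ_mul]
    have ha := h a (by simp)
    have ht := ih fun x hx => h x (by simp [hx])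
    omega

/-- `kdotS < 2^180` (a masked value). -/
theorem kdotS_lt (sh A B : ℕ) : kdotS sh A B < 2 ^ 180 := by
  unfold kdotS
  exact lt_of_le_of_lt (Nat.and_le_right (n := Nat.shiftRight (Nat.mul A B) sh) (m := 2 ^ 180 - 1)) (by norm_num)

/-- ABSTRACT offset arithmetic of the first argument of `pairAbs` (pure naturals; `Z = ZB`). -/
theorem offsetA1 {CL POS xa xb ua1 ub1 uab2 NA NB F4 F45 kc ks : ℕ} {Nm : ℤ}
    (hxa : (xa : ℤ) = ua1 + NA + ZB - F4) (hxb : (xb : ℤ) = ub1 + NB + ZB - F45)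
    (hnum : (kc : ℤ) + ks + POS - (NA + NB) = Nm)
    (hPOS : POS ≤ 2 ^ 178) (hF4 : F4 ≤ 2 ^ 172) (hF45 : F45 ≤ 2 ^ 173) (huab2 : uab2 < 2 ^ 174)
    (hkc : kc < 2 ^ 180) (hks : ks < 2 ^ 180) :
    (((CL + 2 * ZB - POS) + xa + xb - (uab2 + (kc + ks)) : ℕ) : ℤ) =
      CL + 4 * ZB + ua1 + ub1 - uab2 - Nm - (F4 + F45) := by
  have hZ : (ZB : ℤ) = 2 ^ 230 := by norm_num [ZB]
  have hPOS2 : POS ≤ CL + 2 * ZB :=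
    le_trans hPOS (le_trans (Nat.pow_le_pow_right (by norm_num) (by norm_num : 178 ≤ 230)) (by unfold ZB; omega))
  have hG : ((CL + 2 * ZB - POS : ℕ) : ℤ) = CL + 2 * ZB - POS := by push_cast [Nat.cast_sub hPOS2]; try rfl
  have hle : uab2 + (kc + ks) ≤ (CL + 2 * ZB - POS) + xa + xb := by
    have key : (uab2 : ℤ) + (kc + ks) ≤ ((CL + 2 * ZB - POS : ℕ) : ℤ) + xa + xb := by
      rw [hG, hxa, hxb, hZ]
      have : (POS : ℤ) ≤ 2 ^ 178 := by exact_mod_cast hPOS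
      have : (F4 : ℤ) ≤ 2 ^ 172 := by exact_mod_cast hF4
      have : (F45 : ℤ) ≤ 2 ^ 173 := by exact_mod_cast hF45
      have : (uab2 : ℤ) < 2 ^ 174 := by exact_mod_cast huab2
      have : (kc : ℤ) < 2 ^ 180 := by exact_mod_cast hkc
      have : (ks : ℤ) < 2 ^ 180 := by exact_mod_cast hks
      have : (0 : ℤ) ≤ NA := by positivity
      have : (0 : ℤ) ≤ NB := by positivity
      have : (0 : ℤ) ≤ CL := by positivity
      have : (0 : ℤ) ≤ ua1 := by positivity
      have : (0 : ℤ) ≤ ub1 := by positivity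
      linarith
    exact_mod_cast key
  push_cast [Nat.cast_sub hle]
  rw [hG, hxa, hxb, ← hnum]
  ring

/-- ABSTRACT offset arithmetic of the second argument of `pairAbs`. -/
theorem offsetA2 {CH POS ya yb ua2 ub2 uab1 NA NB F4 F45 kc ks : ℕ} {Nm : ℤ}
    (hya : (ya : ℤ) = ua2 + NA + F4) (hyb : (yb : ℤ) = ub2 + NB + F45)
    (hnum : (kc : ℤ) + ks + POS - (NA + NB) = Nm)
    (hPOS : POS ≤ 2 ^ 178) (huab1 : uab1 < 2 ^ 174) (hkc : kc < 2 ^ 180) (hks : ks < 2 ^ 180) :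
    (((CH + 2 * ZB - POS) + ya + yb - (uab1 + (kc + ks)) : ℕ) : ℤ) =
      CH + 2 * ZB + ua2 + ub2 - uab1 - Nm + (F4 + F45) := by
  have hZ : (ZB : ℤ) = 2 ^ 230 := by norm_num [ZB]
  have hPOS2 : POS ≤ CH + 2 * ZB :=
    le_trans hPOS (le_trans (Nat.pow_le_pow_right (by norm_num) (by norm_num : 178 ≤ 230)) (by unfold ZB; omega))
  have hG : ((CH + 2 * ZB - POS : ℕ) : ℤ) = CH + 2 * ZB - POS := by push_cast [Nat.cast_sub hPOS2]; try rfl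
  have hle : uab1 + (kc + ks) ≤ (CH + 2 * ZB - POS) + ya + yb := by
    have key : (uab1 : ℤ) + (kc + ks) ≤ ((CH + 2 * ZB - POS : ℕ) : ℤ) + ya + yb := by
      rw [hG, hya, hyb, hZ]
      have : (POS : ℤ) ≤ 2 ^ 178 := by exact_mod_cast hPOS
      have : (uab1 : ℤ) < 2 ^ 174 := by exact_mod_cast huab1
      have : (kc : ℤ) < 2 ^ 180 := by exact_mod_cast hkc
      have : (ks : ℤ) < 2 ^ 180 := by exact_mod_cast hks
      have : (0 : ℤ) ≤ NA := by positivity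
      have : (0 : ℤ) ≤ NB := by positivity
      have : (0 : ℤ) ≤ CH := by positivity
      have : (0 : ℤ) ≤ ua2 := by positivity
      have : (0 : ℤ) ≤ ub2 := by positivity
      have : (0 : ℤ) ≤ F4 := by positivity
      have : (0 : ℤ) ≤ F45 := by positivity
      linarith
    exact_mod_cast key
  push_cast [Nat.cast_sub hle]
  rw [hG, hya, hyb, ← hnum]
  ring

/-- ABSTRACT conclusion: from the two integer values to `2^164 |R| ≤ max (G₄ ∸ A1) (A2 ∸ G₂)`. -/
theorem abs_le_pairMax {A1 A2 : ℕ} {R v1 v2 : ℝ} (h1 : ((A1 : ℕ) : ℝ) = v1) (h2 : ((A2 : ℕ) : ℝ) = v2)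
    (hlo : ((OZ : ℝ) + 4 * ZB) - v1 ≥ -(2 ^ 164 * R)) (hhi : v2 - ((OZ : ℝ) + 2 * ZB) ≥ 2 ^ 164 * R) :
    2 ^ 164 * |R| ≤ ((max (OZ + 4 * ZB - A1) (A2 - (OZ + 2 * ZB)) : ℕ) : ℝ) := by
  have e1 : ((OZ + 4 * ZB : ℕ) : ℝ) - A1 ≤ ((OZ + 4 * ZB - A1 : ℕ) : ℝ) := by
    have := (Int.cast_le (R := ℝ)).2 (show ((OZ + 4 * ZB : ℕ) : ℤ) - A1 ≤ ((OZ + 4 * ZB - A1 : ℕ) : ℤ) by omega)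
    push_cast at this ⊢; exact this
  have e2 : ((A2 : ℕ) : ℝ) - ((OZ + 2 * ZB : ℕ) : ℝ) ≤ ((A2 - (OZ + 2 * ZB) : ℕ) : ℝ) := by
    have := (Int.cast_le (R := ℝ)).2 (show (A2 : ℤ) - ((OZ + 2 * ZB : ℕ) : ℤ) ≤ ((A2 - (OZ + 2 * ZB) : ℕ) : ℤ) by omega)
    push_cast at this ⊢; exact this
  have m1 : ((OZ + 4 * ZB - A1 : ℕ) : ℝ) ≤ ((max (OZ + 4 * ZB - A1) (A2 - (OZ + 2 * ZB)) : ℕ) : ℝ) := by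
    exact_mod_cast le_max_left _ _
  have m2 : ((A2 - (OZ + 2 * ZB) : ℕ) : ℝ) ≤ ((max (OZ + 4 * ZB - A1) (A2 - (OZ + 2 * ZB)) : ℕ) : ℝ) := by
    exact_mod_cast le_max_right _ _
  push_cast at e1 e2
  rw [h1] at e1; rw [h2] at e2
  rcases abs_choice R with h | h <;> rw [h] <;> linarith

end Summit.RiemannHypothesis.RiemannHypothesis.Theorems.IntegerScrew.Manifest.Fast
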